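import Literature.NumberTheory.EllipticCurves.Sprung2012.HondaOrbitRankOfSurjectiveProofs
import Mathlib.LinearAlgebra.FiniteDimensional.Lemmas
import HarnessLib

/-!
# Sprung 2012 Thm. 2.2 / Cor. 2.10: the joint Coleman map has cokernel `Λ/(T)` modulo `p²` layer functionals independent
# modulo `p` — the FUNCTIONAL-side form of the rank input (proofs only)

Topic `Literature/NumberTheory/EllipticCurves`, cluster `Sprung2012` (namespace = path). A THEOREMS file (no definition, no named
fact; net Literature debt `0`). Cell `bsd-ssimc`, width seat `cruxlead-stmt-BirchSwinnertonDyer-19875-w2` (gen 8), `--supports`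
stmt-BirchSwinnertonDyer-22569. Companion of `Sprung2012/HondaOrbitRankOfSurjectiveProofs.lean` (rank input on the POINTS side: a
surjection `E(ℚ_{p,2}) ↠ ℤ_p^{p²}`): here the same conclusion from the rank input on the FUNCTIONALS side — **`p²` additive maps
`E(ℚ_{p,2}) →+ ℤ_p` independent modulo `p`** — which is the form the tree's own objects produce: the `Λ/ω_2`-orbit
`(f • z₀)|_{E(ℚ_{p,2})}` of the Prop.-7.3 functional (`Sprung2012/ColemanOrbitLayerTwoProofs.lean`:
`exists_functional_lambdaSMul_apply_layer_two_eq_zero_iff`) already gives `p²` functionals independent over `ℤ_p` and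
`p² − p + 1` of them independent mod `p`; the saturation clause of `IsHondaSystem` is expected to supply the remaining `p − 1`
(roadmap (R2) in `Cruxes/SprungLowerDivisibilityAtThree/Lines/chromatic-common-zeros-COKER-w2g8.md`). F. E. I. Sprung, *Iwasawa theory
for elliptic curves at supersingular primes: A pair of main conjectures*, J. Number Theory **132** (2012) [Sprung2012], Thm. 2.2 /
Cor. 2.10 (generation), Lemma 2.3 (rank), Def. 5.9 / Def. 7.1 (the Coleman map).

* `exists_addMonoidHom_dvd_and_not_dvd_of_indep` (private, abstract): `d` functionals independent mod `p` + an orbit GENERATING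
  the functionals mod `p` + `m < d` points ⟹ a functional `≡ 0 (mod p)` on the points and `≢ 0` on the orbit (rank–nullity
  over `𝔽_p`: `LinearMap.ker_ne_bot_of_finrank_lt`).
* `honda_rank_of_indep` — (RANK₂) from such a family on `E(K_2·K_v)` (generation from `exists_eq_mul_of_dvd_evalOn_orbit`).
* **`exists_linearMap_isColemanPair_cokernel_of_indep_rat`** — over `ℚ`, `p ≠ 2` good supersingular: GIVEN `w : Fin p² → (E(ℚ_{p,2}) →+ ℤ_p)`
  independent mod `p`, the joint Coleman map is an injective `Λ`-linear `J` with `Col(z) = J z`, `T·Λ² ⊆ range J`,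
  `ℓ_𝔭(Λ²/range J) = 0` at every prime `𝔭 ∌ T` (`J`/`hJ`/`hcoker` of the F-α skeleton).
HONEST FRAMING: the independent family is displayed, not constructed; nothing about any Selmer group or BSD is asserted.

References: [Sprung2012] Thm. 2.2, Lemma 2.3 (p. 1487), Cor. 2.10 (p. 1489), Def. 5.9 (p. 1495), Def. 7.1–7.2, Props. 7.3/7.6
(pp. 1500–1501); [KuriharaPollack2007] Prop. 1.2; [LeiSujatha2021] §3 (SES-KP); tree `Sprung2012/{HondaOrbitRankOfSurjectiveProofs,
HondaOrbitIndependenceProofs, ColemanOrbitLayerTwoProofs}.lean`, Mathlib `LinearAlgebra/FiniteDimensional/Lemmas`.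
-/

noncomputable section

open scoped Classical

open Polynomial Finset

namespace Literature.NumberTheory.EllipticCurves.Sprung2012

/-! ## §1 Abstract: `d` functionals independent mod `p` + generation ⟹ separation of `m < d` points from the orbit -/

section Abstract

variable {p : ℕ} [Fact p.Prime] {L : Type*} [AddCommGroup L]

/-- `p ∣ x ↔ toZMod x = 0` in `ℤ_p`. [folklore] -/
private theorem padicInt_dvd_iff_toZMod_eq_zero' (x : ℤ_[p]) : (p : ℤ_[p]) ∣ x ↔ PadicInt.toZMod x = 0 := by
  rw [← RingHom.mem_ker, PadicInt.ker_toZMod, PadicInt.maximalIdeal_eq_span_p, Ideal.mem_span_singleton]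

/-- **The rank clause from `d` functionals independent modulo `p` and generation.** `L` an abelian group, `w : Fin d → (L →+ ℤ_p)`
a family of functionals INDEPENDENT MODULO `p` (`∑ λ_t w_t ≡ 0 (mod p)` pointwise forces `p ∣ λ_t` for all `t`), an orbit
`o : ι → L` GENERATING the functionals mod `p` (a functional `≡ 0 (mod p)` on the orbit is `p·w'`), and `m < d` points `x`:
some functional is `≡ 0 (mod p)` on the `x_i` and `≢ 0` somewhere on the orbit — namely `∑ λ_t w_t` for a non-zero solution
`λ̄ ∈ 𝔽_p^d` of the `m` linear equations `∑_t λ̄_t w_t(x_i) ≡ 0` (rank–nullity). [folklore] -/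
private theorem exists_addMonoidHom_dvd_and_not_dvd_of_indep {d m : ℕ} (hmd : m < d) (w : Fin d → (L →+ ℤ_[p]))
    (hw : ∀ c : Fin d → ℤ_[p], (∀ y : L, (p : ℤ_[p]) ∣ ∑ t, c t * w t y) → ∀ t, (p : ℤ_[p]) ∣ c t)
    {ι : Type*} (o : ι → L)
    (hgen : ∀ v : L →+ ℤ_[p], (∀ k, (p : ℤ_[p]) ∣ v (o k)) → ∃ v' : L →+ ℤ_[p], ∀ y, v y = (p : ℤ_[p]) * v' y)
    (x : Fin m → L) :
    ∃ v : L →+ ℤ_[p], (∀ i, (p : ℤ_[p]) ∣ v (x i)) ∧ ∃ k, ¬ (p : ℤ_[p]) ∣ v (o k) := by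
  have hp : p.Prime := Fact.out
  -- the `𝔽_p`-linear map `λ̄ ↦ (∑_t λ̄_t · w_t(x_i) mod p)_i`
  let A : (Fin d → ZMod p) →ₗ[ZMod p] (Fin m → ZMod p) :=
    { toFun := fun c i ↦ ∑ t, c t * PadicInt.toZMod (w t (x i))
      map_add' := fun c c' ↦ funext fun i ↦ by
        simp only [Pi.add_apply, add_mul, sum_add_distrib]
      map_smul' := fun a c ↦ funext fun i ↦ by
        simp only [Pi.smul_apply, smul_eq_mul, RingHom.id_apply, mul_sum, mul_assoc] }
  have hker : LinearMap.ker A ≠ ⊥ :=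
    LinearMap.ker_ne_bot_of_finrank_lt (by rw [Module.finrank_fin_fun, Module.finrank_fin_fun]; exact hmd)
  obtain ⟨cbar, hcA, hc0⟩ := (Submodule.ne_bot_iff _).mp hker
  -- lift the coefficients and form `v = ∑ λ_t w_t`
  let cl : Fin d → ℤ_[p] := fun t ↦ ((cbar t).val : ℤ_[p])
  have hcl : ∀ t, PadicInt.toZMod (cl t) = cbar t := fun t ↦ by
    change PadicInt.toZMod (((cbar t).val : ℕ) : ℤ_[p]) = cbar t
    rw [map_natCast, ZMod.natCast_zmod_val]
  let v : L →+ ℤ_[p] :=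
    { toFun := fun y ↦ ∑ t, cl t * w t y
      map_zero' := by simp
      map_add' := fun y y' ↦ by rw [← sum_add_distrib]; exact sum_congr rfl fun t _ ↦ by rw [map_add, mul_add] }
  have hv : ∀ y, v y = ∑ t, cl t * w t y := fun y ↦ rfl
  refine ⟨v, fun i ↦ ?_, ?_⟩
  · rw [padicInt_dvd_iff_toZMod_eq_zero', hv, map_sum]
    have h := congrFun (LinearMap.mem_ker.mp hcA) i
    change ∑ t, cbar t * PadicInt.toZMod (w t (x i)) = 0 at h
    rw [← h]
    exact sum_congr rfl fun t _ ↦ by rw [map_mul, hcl]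
  · by_contra hall
    push Not at hall
    obtain ⟨v', hv'⟩ := hgen v hall
    apply hc0
    funext t
    have hdiv : ∀ y, (p : ℤ_[p]) ∣ ∑ t, cl t * w t y := fun y ↦ by rw [← hv, hv']; exact dvd_mul_right _ _
    have ht := hw cl hdiv t
    rw [padicInt_dvd_iff_toZMod_eq_zero', hcl] at ht
    rw [ht, Pi.zero_apply]

end Abstract

/-! ## §2 The layer `E(K_2·K_v)`: (RANK₂) from `p²` functionals independent modulo `p` -/

section Local

universe u

variable {K : Type u} [Field K] {p : ℕ} [Fact p.Prime] (κ : ZpExtension K p)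
variable {E : Type u} [Field E] [Algebra K E] (ι : AlgebraicClosure K →ₐ[K] AlgebraicClosure E)
variable (W : WeierstrassCurve K)

open Literature.NumberTheory.EllipticCurves Literature.NumberTheory.GaloisRepresentations ZpExtension
  Literature.NumberTheory.EllipticCurves.Kobayashi2003 Literature.NumberTheory.EllipticCurves.Sprung2017

variable {κ ι W}

/-- **(RANK₂) from `p²` layer functionals independent modulo `p`** (and the Honda generation clauses): for every family of
`p² − 1` points of `E(K_2·K_v)` some functional is `≡ 0 (mod p)` on the family and `≢ 0` at some orbit point `gʲc_2` or `gʲc_1`.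
This is the form of the rank input that the tree's own objects can eventually supply: the `Λ/ω_2`-orbit of the Prop.-7.3
functional (`ColemanOrbitLayerTwoProofs`) gives `p²` functionals independent over `ℤ_p`, and `p² − p + 1` of them
independent mod `p`; the saturation clause supplies the rest. [cite: Sprung2012, Thm. 2.2 and Lemma 2.3 (p. 1487), Cor. 2.10 (p. 1489)] -/
theorem honda_rank_of_indep {ap : ℤ} {g : Field.absoluteGaloisGroup E} {cneg : localPoints W E}
    {c : ℕ → localPoints W E} (hH : IsHondaSystem κ ι W ap g cneg c)
    (w : Fin (p ^ 2) → (localLayerPointsOfEmb κ ι W 2 →+ ℤ_[p]))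
    (hw : ∀ cf : Fin (p ^ 2) → ℤ_[p], (∀ y, (p : ℤ_[p]) ∣ ∑ t, cf t * w t y) → ∀ t, (p : ℤ_[p]) ∣ cf t) :
    ∀ x : Fin (p ^ 2 - 1) → localPoints W E, (∀ i, x i ∈ localLayerPointsOfEmb κ ι W 2) →
      ∃ v : localLayerPointsOfEmb κ ι W 2 →+ ℤ_[p],
        (∀ i, (p : ℤ_[p]) ∣ evalOn W (localLayerPointsOfEmb κ ι W 2) v (x i)) ∧
        ((∃ j : ℕ, ¬ (p : ℤ_[p]) ∣ evalOn W (localLayerPointsOfEmb κ ι W 2) v (g ^ j • c 2)) ∨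
          ∃ j : ℕ, ¬ (p : ℤ_[p]) ∣ evalOn W (localLayerPointsOfEmb κ ι W 2) v (g ^ j • c 1)) := by
  intro x hx
  have hp : p.Prime := Fact.out
  have hc2 : ∀ j : ℕ, g ^ j • c 2 ∈ localLayerPointsOfEmb κ ι W 2 := fun j ↦
    smul_mem_localLayerPointsOfEmb κ ι W 2 _ (hH.2.1 2)
  have hc1 : ∀ j : ℕ, g ^ j • c 1 ∈ localLayerPointsOfEmb κ ι W 2 := fun j ↦
    smul_mem_localLayerPointsOfEmb κ ι W 2 _ (localLayerPointsOfEmb_mono κ ι W (by norm_num : 1 ≤ 2) (hH.2.1 1))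
  let o : ℕ ⊕ ℕ → localLayerPointsOfEmb κ ι W 2 :=
    fun k ↦ Sum.elim (fun j ↦ ⟨g ^ j • c 2, hc2 j⟩) (fun j ↦ ⟨g ^ j • c 1, hc1 j⟩) k
  have hgen : ∀ v : localLayerPointsOfEmb κ ι W 2 →+ ℤ_[p], (∀ k, (p : ℤ_[p]) ∣ v (o k)) →
      ∃ v' : localLayerPointsOfEmb κ ι W 2 →+ ℤ_[p], ∀ y, v y = (p : ℤ_[p]) * v' y := by
    intro v hv
    refine exists_eq_mul_of_dvd_evalOn_orbit hH (by norm_num : 1 ≤ 2) v (fun j ↦ ?_) (fun j ↦ ?_)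
    · rw [evalOn_of_mem W _ v (hc2 j)]
      exact hv (Sum.inl j)
    · rw [evalOn_of_mem W _ v (hc1 j)]
      exact hv (Sum.inr j)
  have hlt : p ^ 2 - 1 < p ^ 2 := Nat.sub_lt (pow_pos hp.pos 2) Nat.one_pos
  obtain ⟨v, hvx, k, hk⟩ := exists_addMonoidHom_dvd_and_not_dvd_of_indep hlt w hw o hgen (fun i ↦ ⟨x i, hx i⟩)
  refine ⟨v, fun i ↦ by rw [evalOn_of_mem W _ v (hx i)]; exact hvx i, ?_⟩
  rcases k with j | j
  · exact Or.inl ⟨j, by rw [evalOn_of_mem W _ v (hc2 j)]; exact hk⟩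
  · exact Or.inr ⟨j, by rw [evalOn_of_mem W _ v (hc1 j)]; exact hk⟩

end Local

/-! ## §3 Over `ℚ`: the joint Coleman map with cokernel `Λ/(T)` modulo `p²` layer functionals independent mod `p` -/

section Rat

open NumberField IsDedekindDomain Literature.NumberTheory.EllipticCurves Literature.NumberTheory.GaloisRepresentations
  ZpExtension Literature.NumberTheory.EllipticCurves.Kobayashi2003 Literature.NumberTheory.EllipticCurves.Sprung2017

/-- **(SES-KP) over `ℚ` modulo «`p²` functionals on `E(ℚ_{p,2})` independent modulo `p`».** `W/ℚ` elliptic globally minimal,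
`p ≠ 2` good supersingular, any `ℤ_p`-extension `κ`, `v ∋ p`, the chosen embedding, `g` a local lift of the topological generator,
`(c_{−1}, c)` a Honda system, and a family `w` of `p²` additive maps `E(ℚ_p·ℚ_2) →+ ℤ_p` independent modulo `p`
(`∑ λ_t w_t ≡ 0 (mod p)` pointwise ⟹ all `λ_t ≡ 0`; = «`dim_{𝔽_p} E(ℚ_{p,2})/p ≥ p²`», i.e. `Ê(ℚ_{p,2})` of rank `p²`): the joint
Coleman map is an INJECTIVE `Λ`-linear `J : H¹_Iw(T) → Λ × Λ` with `Col(z) = J z`, `T·Λ² ⊆ range J`, and `ℓ_𝔭(Λ²/range J) = 0`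
at every prime `𝔭 ∌ T` — the hypotheses `J`/`hJ`/`hcoker` of the F-α skeleton. The functional family asked for is what
`ColemanOrbitLayerTwoProofs` begins to supply in-tree (`p² − p + 1` of the `p²` directions).
[cite: Sprung2012, Thm. 2.2, Lemma 2.3 (p. 1487), Def. 5.9 (p. 1495), Def. 7.1–7.2, Props. 7.3/7.6 (pp. 1500–1501)]
[cite: KuriharaPollack2007, Prop. 1.2] [cite: LeiSujatha2021, §3 (SES-KP)] -/
theorem exists_linearMap_isColemanPair_cokernel_of_indep_rat (W : WeierstrassCurve ℚ) [W.IsElliptic]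
    [W.IsGloballyMinimal] (p : ℕ) [Fact p.Prime] (hp2 : p ≠ 2) (hgood : W.HasGoodReductionAtPrime p)
    (hap : (p : ℤ) ∣ W.frobeniusTrace p) (κ : ZpExtension ℚ p) {v : HeightOneSpectrum (𝓞 ℚ)} (hpv : (p : 𝓞 ℚ) ∈ v.asIdeal)
    {g : Field.absoluteGaloisGroup (v.adicCompletion ℚ)}
    (hg : κ.IsTopGenerator (resGalOfEmb (closureEmb (K := ℚ) (v.adicCompletion ℚ)) g))
    {cneg : localPoints W (v.adicCompletion ℚ)} {c : ℕ → localPoints W (v.adicCompletion ℚ)}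
    (hH : IsHondaSystem κ (closureEmb (K := ℚ) (v.adicCompletion ℚ)) W (W.frobeniusTrace p) g cneg c)
    (w : Fin (p ^ 2) → (localLayerPointsOfEmb κ (closureEmb (K := ℚ) (v.adicCompletion ℚ)) W 2 →+ ℤ_[p]))
    (hw : ∀ cf : Fin (p ^ 2) → ℤ_[p], (∀ y, (p : ℤ_[p]) ∣ ∑ t, cf t * w t y) → ∀ t, (p : ℤ_[p]) ∣ cf t) :
    letI := moduleOfGenerator κ (closureEmb (K := ℚ) (v.adicCompletion ℚ)) W hg
    ∃ J : (localTowerPointsOfEmb κ (closureEmb (K := ℚ) (v.adicCompletion ℚ)) W →+ ℤ_[p]) →ₗ[IwasawaAlgebra p]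
        IwasawaAlgebra p × IwasawaAlgebra p,
      (∀ z, IsColemanPair κ (closureEmb (K := ℚ) (v.adicCompletion ℚ)) W (W.frobeniusTrace p) g c z (J z).1 (J z).2) ∧
      Function.Injective J ∧
      (∀ x y : IwasawaAlgebra p, ∃ z, J z = (PowerSeries.X * x, PowerSeries.X * y)) ∧
      ∀ 𝔭 : PrimeSpectrum (IwasawaAlgebra p), (PowerSeries.X : IwasawaAlgebra p) ∉ 𝔭.asIdeal →
        Module.lengthAt (IwasawaAlgebra p) ((IwasawaAlgebra p × IwasawaAlgebra p) ⧸ LinearMap.range J) 𝔭 = 0 :=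
  exists_linearMap_isColemanPair_cokernel_of_rank_rat W p hp2 hgood hap κ hpv hg hH (honda_rank_of_indep hH w hw)

end Rat

end Literature.NumberTheory.EllipticCurves.Sprung2012

end
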